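import Summits.CriticalPhenomena.Ising3DConformalLimit.Theorems.AnomalousForcesInteractionGaussianLimitIsFreeLatticeDecoupling
import Literature.MathematicalPhysics.QuantumLattice.LatticeFieldShellMarkov
import Literature.Probability.LatticeModels.GibbsSpecificationDLRProofs
import HarnessLib

/-!
# Crux `GaussianLimitIsFree` (item stmt-CriticalPhenomena-2601), line `registered` (v10, lead c4):
# (D) for the EXACT lattice approximants of the realised law — smeared DLR (Gibbs) states

THEOREM-ONLY file (`--supports stmt-CriticalPhenomena-2601`, registered sub-goal
`stub_sphereDecoupling_gibbs`).  `fieldRealisation_proof` (item 11245) builds the law `μ` of the stub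
`stub_sphereDecoupling_limit` as the limit in law of `μ_δ = spinFieldLaw ν (box 3 (L δ)) δ (ρ δ)`, where `ν`
is the plus DLR state at `β_c` — an INFINITE-volume Gibbs measure smeared over a growing box, not a
finite-volume law with frozen boundary condition.  `…LatticeDecoupling.lean` proved the decoupling
inequality (D) for the latter; this file proves it for the former, i.e. for the exact approximants:

* `condIndepCondExp_of_isGibbsMeasure_ising` — Markov property of ANY Gibbs measure `ν` of the
  nearest-neighbour Ising specification of a locally finite graph on a countable vertex set across a finite
  volume `I`: a σ-algebra of events off `I` that sees the spins of `∂ᵉˣI` splits the `I`-local events from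
  the events off `I` (DLR for the one volume `I`, `IsGibbsMeasure.condExp_ae_eq_integral`, and locality of
  `η ↦ μ^η_I(A)` in `∂ᵉˣI`, `isingExpect_fixed_congr_outerBoundary`; no global Markov property is involved).
* `condIndepCondExp_shell_spinFieldLaw_of_isGibbs` — hence the smeared field `Φ_δ = ρ δᵈ ∑_{x ∈ Λ} σ_x δ_{δx}`
  of a Gibbs measure is Markov across the shell `B(c, r+ε) ∖ B̄(c, r)` at mesh `0 < δ < ε`, PROVIDED the box
  `Λ` contains every site within `r + δ` of `c` at mesh `δ` (otherwise a boundary spin of the interior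
  volume is invisible to the field and the splitting genuinely fails).
* `sphereDecoupling_spinFieldLaw_of_isGibbs` (= `stub_sphereDecoupling_gibbs`, `d = 3`) — (D_ε) across the
  unit sphere for `spinFieldLaw ν Λ δ ρ`, `ν` Gibbs, `0 < δ < ε`, `Λ ⊇ {x : ‖δx‖ ≤ 1 + δ}`; for the
  approximants of `fieldRealisation_proof` (`Λ = box 3 (L δ)`, `δ L(δ) → ∞`) the proviso holds for all
  small `δ`.

So (D) holds along the very sequence whose limit in law is `μ`; the crux is its survival in that limit.

References: H.-O. Georgii, *Gibbs Measures and Phase Transitions* (2011), Remark 1.24, Ex. 2.12;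
S. Friedli, Y. Velenik (2017), §3.6.3 eq. (3.26), §6.3.1 eq. (6.23); Yu. A. Rozanov (1982), Ch. 2 §1.1.
-/

noncomputable section

namespace Summit.CriticalPhenomena.Ising3DConformalLimit.Cruxes.GaussianLimitIsFree.Birth

open MeasureTheory Filter Set
open scoped ProbabilityTheory Topology ENNReal SchwartzMap
open Literature.MathematicalPhysics.QuantumLattice
open Literature.Probability.LatticeModels

/-! ### Markov property of a Gibbs measure across a finite volume -/

section GibbsMarkov

variable {V : Type*} [Countable V] (G : SimpleGraph V) [DecidableEq V] [G.LocallyFinite]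

/-- **Markov property of a DLR state across a finite volume** (Georgii 2011, Remark 1.24 with the
nearest-neighbour locality of Ex. 2.12; Friedli–Velenik 2017, eq. (3.26)): let `ν` be a Gibbs measure of
the Ising specification of `G` and `I` a finite volume.  If a σ-algebra `m''` of events off `I` makes every
boundary spin `σ_y`, `y ∈ ∂ᵉˣI`, measurable, then `m''` splits every σ-algebra `m₁` of `I`-local events
from every σ-algebra `m₂` of events off `I`.  Proof: `ν[1_A | 𝓕_{Iᶜ}] = μ^·_I(A)` (DLR for the volume
`I`), which depends on the boundary condition only through `∂ᵉˣI`, hence has an `m''`-measurable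
version; tower and pull-out (`condIndepCondExp_of_condExp_version`). [cite: Georgii2011, Remark 1.24] -/
theorem condIndepCondExp_of_isGibbsMeasure_ising {ν : Measure (SpinConfig V)} (β h : ℝ)
    (hν : IsGibbsMeasure (isingSpecification G β h) ν) (I : Finset V)
    {m'' m₁ m₂ : MeasurableSpace (SpinConfig V)}
    (hm'' : m'' ≤ cylinderEvents (X := fun _ : V => ℤˣ) ((↑I : Set V)ᶜ))
    (hbd : ∀ y ∈ outerBoundary G I, Measurable[m''] fun η : SpinConfig V => η y)
    (hm₁ : m₁ ≤ cylinderEvents (X := fun _ : V => ℤˣ) (↑I : Set V))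
    (hm₂ : m₂ ≤ cylinderEvents (X := fun _ : V => ℤˣ) ((↑I : Set V)ᶜ)) :
    CondIndepCondExp m'' m₁ m₂ ν := by
  classical
  -- adapted from `Literature.MathematicalPhysics.QuantumLattice.condIndepCondExp_isingMeasure_fixed`
  letI mpi : MeasurableSpace (SpinConfig V) := MeasurableSpace.pi
  haveI := hν.isProbabilityMeasure
  refine condIndepCondExp_of_condExp_version hm'' cylinderEvents_le_pi
    (hm₁.trans cylinderEvents_le_pi) hm₂ fun A hA => ?_
  have hAI : MeasurableSet[cylinderEvents (X := fun _ : V => ℤˣ) (↑I : Set V)] A := hm₁ A hA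
  have hA' : MeasurableSet A := cylinderEvents_le_pi A hAI
  set χ : SpinConfig V → ℝ := A.indicator fun _ => (1 : ℝ) with hχ
  have hχm : Measurable χ := measurable_const.indicator hA'
  have hχb : ∀ σ, |χ σ| ≤ 1 := fun σ => by
    by_cases hσ : σ ∈ A
    · simp [hχ, Set.indicator_of_mem hσ]
    · simp [hχ, Set.indicator_of_notMem hσ]
  have hχloc : ∀ σ σ' : SpinConfig V, (∀ x ∈ I, σ x = σ' x) → χ σ = χ σ' := by
    intro σ σ' hσσ'
    have hiff : σ ∈ A ↔ σ' ∈ A :=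
      mem_iff_mem_of_measurableSet_cylinderEvents hAI fun x hx => hσσ' x (Finset.mem_coe.1 hx)
    by_cases hσ : σ ∈ A
    · rw [hχ, Set.indicator_of_mem hσ, Set.indicator_of_mem (hiff.1 hσ)]
    · rw [hχ, Set.indicator_of_notMem hσ, Set.indicator_of_notMem fun h' => hσ (hiff.2 h')]
  -- the kernel `g ζ = μ^ζ_I(A)`
  set g : SpinConfig V → ℝ := fun ζ => ∫ σ, χ σ ∂(isingMeasure G I β h (.fixed ζ)) with hg
  -- `g` depends only on the spins of `∂ᵉˣI`
  have hgdep : ∀ η η' : SpinConfig V, (∀ y ∈ outerBoundary G I, η y = η' y) → g η = g η' := by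
    intro η η' hηη'
    simp only [hg]
    exact isingExpect_fixed_congr_outerBoundary G hηη' β h hχm hχloc
  -- hence `g` is `m''`-measurable
  have hres : Measurable[m''] fun (η : SpinConfig V) (y : ↥(outerBoundary G I)) => η y :=
    @measurable_pi_lambda _ _ _ m'' _ _ fun y => hbd y y.2
  let e : (↥(outerBoundary G I) → ℤˣ) → SpinConfig V :=
    fun ζ x => if hx : x ∈ outerBoundary G I then ζ ⟨x, hx⟩ else 1
  have hfac : g = (g ∘ e) ∘ fun (η : SpinConfig V) (y : ↥(outerBoundary G I)) => η y := by
    funext η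
    simp only [Function.comp_apply]
    refine hgdep η _ fun y hy => ?_
    simp only [e, dif_pos hy]
  have hgm : StronglyMeasurable[m''] g := by
    refine Measurable.stronglyMeasurable ?_
    rw [hfac]
    exact (measurable_of_countable (g ∘ e)).comp hres
  have hgb : ∀ η, |g η| ≤ 1 := fun η => by
    simp only [hg]
    have := norm_integral_le_of_norm_le_const (μ := isingMeasure G I β h (.fixed η))
      (C := 1) (f := χ) (ae_of_all _ fun σ => by rw [Real.norm_eq_abs]; exact hχb σ)
    simpa [Real.norm_eq_abs] using this
  -- DLR for the one volume `I`
  have hDLR : ν[χ | cylinderEvents (X := fun _ : V => ℤˣ) ((↑I : Set V)ᶜ)] =ᵐ[ν] g :=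
    hν.condExp_ae_eq_integral (isSpecification_isingSpecification_holds G β h) I hχm hχb
  exact ⟨g, hgm, ⟨1, hgb⟩, hDLR⟩

end GibbsMarkov

/-! ### Thick-shell splitting and (D) for smeared Gibbs states -/

section Shell

open Metric

variable {d : ℕ}

/-- **Smeared DLR states are Markov across every spherical shell thicker than the mesh** — the
infinite-volume analogue of `condIndepCondExp_shell_spinFieldLaw_isingMeasure`: for a Gibbs measure `ν`
of the nearest-neighbour Ising specification of `ℤᵈ`, mesh `0 < δ < ε`, field strength `ρ ≠ 0` and a box
`Λ` containing every site within `r + δ` of the centre `c` at mesh `δ`, the law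
`spinFieldLaw ν Λ δ ρ` makes the events of `B(c, r)` and the events off `B̄(c, r + ε/2)` conditionally
independent given the events of the shell `B(c, r+ε) ∖ B̄(c, r)`. [cite: FriedliVelenik2017, Exercise 3.11, eq. (3.26)] -/
theorem condIndepCondExp_shell_spinFieldLaw_of_isGibbs {ν : Measure (SpinConfig (Site d))}
    {β h : ℝ} (hν : IsGibbsMeasure (isingSpecification (zdGraph d) β h) ν) (Λ : Finset (Site d))
    {δ ρ : ℝ} (hδ : 0 < δ) (hρ : ρ ≠ 0) (c : EuclideanSpace ℝ (Fin d)) (r ε : ℝ) (hδε : δ < ε)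
    (hΛ : ∀ x : Site d, dist (δ • siteToE x) c ≤ r + δ → x ∈ Λ) :
    CondIndepCondExp (extEvents (ball c (r + ε) \ closedBall c r)) (extEvents (ball c r))
      (extEvents (closedBall c (r + ε / 2))ᶜ) (spinFieldLaw ν Λ δ ρ) := by
  classical
  -- adapted from `Literature.MathematicalPhysics.QuantumLattice.condIndepCondExp_shell_spinFieldLaw_isingMeasure`
  haveI := hν.isProbabilityMeasure
  have hε : 0 < ε := hδ.trans hδε
  rw [spinFieldLaw]
  refine CondIndepCondExp.map_of_comap (measurable_spinField Λ δ ρ) (extEvents_le _)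
    (extEvents_le _) (extEvents_le _) ?_
  set I : Finset (Site d) := Λ.filter fun x => dist (δ • siteToE x) c ≤ r with hI
  have hmemI : ∀ {x : Site d}, x ∈ I ↔ x ∈ Λ ∧ dist (δ • siteToE x) c ≤ r := fun {x} => by
    rw [hI, Finset.mem_filter]
  refine condIndepCondExp_of_isGibbsMeasure_ising (zdGraph d) β h hν I ?_ ?_ ?_ ?_
  · -- shell events pull back to events off `I`
    refine (comap_spinField_extEvents_le Λ δ ρ _).trans (cylinderEvents_mono ?_)
    rintro x ⟨-, hxU⟩ hxI
    exact hxU.2 (mem_closedBall.2 (hmemI.1 (Finset.mem_coe.1 hxI)).2)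
  · -- every boundary spin of `I` lies in `Λ` and is seen by the shell events
    intro y hy
    obtain ⟨hyI, x, hxI, hadj⟩ := mem_outerBoundary_iff.1 hy
    have hxr : dist (δ • siteToE x) c ≤ r := (hmemI.1 hxI).2
    have hdist : dist (δ • siteToE y) c ≤ r + δ :=
      calc dist (δ • siteToE y) c
          ≤ dist (δ • siteToE y) (δ • siteToE x) + dist (δ • siteToE x) c := dist_triangle _ _ _
        _ = |δ| + dist (δ • siteToE x) c := by rw [dist_smul_siteToE_of_adj hadj]
        _ ≤ δ + r := by rw [abs_of_pos hδ]; linarith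
        _ = r + δ := add_comm _ _
    have hyΛ : y ∈ Λ := hΛ y hdist
    have hyr : r < dist (δ • siteToE y) c := by
      by_contra hle
      exact hyI (hmemI.2 ⟨hyΛ, not_lt.1 hle⟩)
    have hyshell : δ • siteToE y ∈ ball c (r + ε) \ closedBall c r := by
      refine ⟨mem_ball.2 ?_, fun h' => (not_le.2 hyr) (mem_closedBall.1 h')⟩
      linarith
    have hopen : IsOpen (ball c (r + ε) \ closedBall c r) := isOpen_ball.sdiff isClosed_closedBall
    obtain ⟨R, hR, hRsub⟩ := Metric.isOpen_iff.1 hopen _ hyshell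
    obtain ⟨f, hfsupp, hfy⟩ :=
      exists_schwartz_tsupport_subset_ball (δ • siteToE y) (lt_min hR hδ)
    refine measurable_apply_comap_spinField Λ hδ.ne' hρ hyΛ
      (hfsupp.trans ((ball_subset_ball (min_le_left _ _)).trans hRsub)) (fun x _ hxy => ?_) hfy
    refine image_eq_zero_of_notMem_tsupport fun hx => ?_
    have h1 : dist (δ • siteToE x) (δ • siteToE y) < min R δ := mem_ball.1 (hfsupp hx)
    have h2 : δ ≤ dist (δ • siteToE x) (δ • siteToE y) := le_dist_smul_siteToE_of_ne hxy hδ.le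
    exact absurd (h1.trans_le (min_le_right _ _)) (not_lt.2 h2)
  · -- interior events pull back to `I`-local events
    refine (comap_spinField_extEvents_le Λ δ ρ _).trans (cylinderEvents_mono ?_)
    rintro x ⟨hxΛ, hxU⟩
    exact Finset.mem_coe.2 (hmemI.2 ⟨hxΛ, (mem_ball.1 hxU).le⟩)
  · -- exterior events pull back to events off `I`
    refine (comap_spinField_extEvents_le Λ δ ρ _).trans (cylinderEvents_mono ?_)
    rintro x ⟨-, hxU⟩ hxI
    have hxr := (hmemI.1 (Finset.mem_coe.1 hxI)).2
    exact hxU (mem_closedBall.2 (by linarith))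

end Shell

section Decoupling

/-- **(D) for smeared Gibbs states on `ℤ³`.**  For a Gibbs measure `ν` of the nearest-neighbour Ising
specification of `ℤ³` (any `β`, `h`; e.g. the plus state at `β_c` used by `fieldRealisation_proof`), mesh
`0 < δ < ε`, field strength `ρ ≠ 0` and a box `Λ` containing every site `x` with `‖δx‖ ≤ 1 + δ`, the law
`μ_δ = spinFieldLaw ν Λ δ ρ` satisfies the `L²` decoupling inequality across the unit sphere at width `ε`:
for `w` supported in `B(0,1)` and `v` supported off `B̄(0, 1+ε)`,
`|∫ ω(w)ω(v) dμ_δ| ≤ (∫ E_{μ_δ}[ω(w) | fieldSigma ((∂B)^ε)]² dμ_δ)^{1/2} (∫ ω(v)² dμ_δ)^{1/2}`.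
[cite: FriedliVelenik2017, Exercise 3.11, eq. (3.26)] -/
theorem sphereDecoupling_spinFieldLaw_of_isGibbs {ν : Measure (SpinConfig (Site 3))} {β h : ℝ}
    (hν : IsGibbsMeasure (isingSpecification (zdGraph 3) β h) ν) (Λ : Finset (Site 3))
    {δ ρ ε : ℝ} (hδ : 0 < δ) (hρ : ρ ≠ 0) (hδε : δ < ε)
    (hΛ : ∀ x : Site 3, ‖δ • siteToE x‖ ≤ 1 + δ → x ∈ Λ)
    {w v : 𝓢(EuclideanSpace ℝ (Fin 3), ℝ)}
    (hw : tsupport ⇑w ⊆ Metric.ball (0 : EuclideanSpace ℝ (Fin 3)) 1)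
    (hv : tsupport ⇑v ⊆ (Metric.closedBall (0 : EuclideanSpace ℝ (Fin 3)) (1 + ε))ᶜ) :
    |∫ ω, ω w * ω v ∂(spinFieldLaw ν Λ δ ρ)| ≤
      Real.sqrt (∫ ω, ((spinFieldLaw ν Λ δ ρ)[(fun ω : FieldConfig (EuclideanSpace ℝ (Fin 3)) => ω w) |
          fieldSigma (Metric.thickening ε (Metric.sphere (0 : EuclideanSpace ℝ (Fin 3)) 1))]) ω ^ 2
          ∂(spinFieldLaw ν Λ δ ρ)) *
      Real.sqrt (∫ ω, (ω v) ^ 2 ∂(spinFieldLaw ν Λ δ ρ)) := by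
  haveI := hν.isProbabilityMeasure
  have hshell := condIndepCondExp_shell_spinFieldLaw_of_isGibbs hν Λ hδ hρ
    (0 : EuclideanSpace ℝ (Fin 3)) 1 ε hδε (fun x hx => hΛ x (by rwa [dist_zero_right] at hx))
  exact sphereDecoupling_of_shellSplitting (hδ.trans hδε).le hshell hw hv
    (memLp_two_eval_spinFieldLaw _ Λ δ ρ w) (memLp_two_eval_spinFieldLaw _ Λ δ ρ v)

/-- **Registered form (sub-goal `stub_sphereDecoupling_gibbs` of crux stmt-CriticalPhenomena-2601, skeleton
v10): (D) for the smeared DLR states of `ℤ³`** — `sphereDecoupling_spinFieldLaw_of_isGibbs` with all arguments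
explicit (compare the open stub `stub_sphereDecoupling_limit`: the same inequality for the limit law).
[cite: FriedliVelenik2017, Exercise 3.11, eq. (3.26)] -/
theorem stub_sphereDecoupling_gibbs :
    ∀ (ν : MeasureTheory.Measure (Literature.Probability.LatticeModels.SpinConfig (Literature.Probability.LatticeModels.Site 3))) (β h : ℝ), Literature.Probability.LatticeModels.IsGibbsMeasure (Literature.Probability.LatticeModels.isingSpecification (Literature.Probability.LatticeModels.zdGraph 3) β h) ν → ∀ (Λ : Finset (Literature.Probability.LatticeModels.Site 3)) (δ ρ ε : ℝ), 0 < δ → ρ ≠ 0 → δ < ε → (∀ x : Literature.Probability.LatticeModels.Site 3, ‖δ • Literature.MathematicalPhysics.QuantumLattice.siteToE x‖ ≤ 1 + δ → x ∈ Λ) → ∀ (w v : SchwartzMap (EuclideanSpace ℝ (Fin 3)) ℝ), tsupport ⇑w ⊆ Metric.ball (0 : EuclideanSpace ℝ (Fin 3)) 1 → tsupport ⇑v ⊆ (Metric.closedBall (0 : EuclideanSpace ℝ (Fin 3)) (1 + ε))ᶜ → |∫ ω, ω w * ω v ∂(Literature.MathematicalPhysics.QuantumLattice.spinFieldLaw ν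 Λ δ ρ)| ≤ Real.sqrt (∫ ω, (MeasureTheory.condExp (Literature.MathematicalPhysics.QuantumLattice.fieldSigma (Metric.thickening ε (Metric.sphere (0 : EuclideanSpace ℝ (Fin 3)) 1))) (Literature.MathematicalPhysics.QuantumLattice.spinFieldLaw ν Λ δ ρ) (fun ω : Literature.MathematicalPhysics.QuantumLattice.FieldConfig (EuclideanSpace ℝ (Fin 3)) => ω w)) ω ^ 2 ∂(Literature.MathematicalPhysics.QuantumLattice.spinFieldLaw ν Λ δ ρ)) * Real.sqrt (∫ ω, (ω v) ^ 2 ∂(Literature.MathematicalPhysics.QuantumLattice.spinFieldLaw ν Λ δ ρ)) := by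
  intro ν β h hν Λ δ ρ ε hδ hρ hδε hΛ w v hw hv
  exact sphereDecoupling_spinFieldLaw_of_isGibbs hν Λ hδ hρ hδε hΛ hw hv

end Decoupling

end Summit.CriticalPhenomena.Ising3DConformalLimit.Cruxes.GaussianLimitIsFree.Birth

end
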